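import Summits.ResolutionOfSingularities.ResolutionOfSingularities.Theorems.WeightedInvariantIota3JSigmaPtMapOfIdealDescent
import HarnessLib

/-!
# The levels of an upstairs flag with `q = r₂` ARE extended (one-member descent + the canonical congruence C2); so both ideal-descent
# inputs of `stub_keyRungGrHomLE_three` are needed at `q < r₂` only (door `HypersurfaceCentreConstruction`, stmt-ResolutionOfSingularities-19897;
# P3 rung, gaps (σ-ext)₃ / GAP 2)

Topic: `Summits/ResolutionOfSingularities/ResolutionOfSingularities/Theorems`. Helper for the door item `HypersurfaceCentreConstruction`
(stmt-ResolutionOfSingularities-19897, route `WeightedInvariant`), line `local-engine` (skeleton v3.12 `7a4b52ef`), def-free.  Sequel of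
`keyRungGrHomLE_three_of_idealDescent3'` (…Iota3JSigmaPtMapOfIdealDescent, p820058).

**`levels_extended_of_r₂_eq_q`** (dimension three, `φ : S → S'` local formally smooth e.f.t., `𝔪S' = 𝔪'`, `f ∈ 𝔪 ∖ 0`): if a two-flag
`(g₁', g₂')` of `S'` carries `φ f` to `(r₂; r₁, r₂)` (the COARSE triples `q = r₂`), then BOTH levels `F'(r₁)`, `F'(r₂)` are extended from `S`:
at `q = r₂` the filtration is the one-flag rational filtration of `g₁'` (`flagContactFiltration_eq_ratContactFiltration`); `g₁'` reaches
`r₁/r₂`, so by one-member descent (`JFlatEssSmooth.oneFlagReaches_of_algebraMap`, Hironaka's vertex preparation) a rational `y` reaches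
`r₁/r₂`, and by the canonical congruence C2 (`RatContactCanonical.exists_unit_sub_mul_mem_pow_of_mem_ratContactFiltration`: two parameters
carrying `φ f` to the same slope `> 1` are congruent up to a unit modulo `𝔪'^⌈r₁/r₂⌉`; at slope `1` the congruence modulo `𝔪'` is free)
`RC_{g₁'} = RC_{φ y} = RC_y · S'` in every degree.  Hence (§2) the σ-maximiser ideal-descent input (IDLmax-desc)₃ of GAP 2 is needed only
at `q < r₂` (`maxIdealDescent_of_lt`), exactly like (IDL-desc)₃; gap list **`keyRungGrHomLE_three_of_idealDescentLT3`**.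

[OURS · L1 W4.3 · kernel lemma + audit glue]  Replaces the role of NO printed item; NOT a statement of the manuscript
[claim: Hironaka2017, status: under-review]; candidates stay candidates; AI work, weaker than expert review.  No definition; no axiom.

## References

* H. Hironaka, *Characteristic polyhedra of singularities*, J. Math. Kyoto Univ. 7 (1967), §3, Thm. (4.8). [Hironaka1967]
* V. Cossart, U. Jannsen, S. Saito, *Desingularization*, LNM 2270 (2020), Lemma 8.3. [CossartJannsenSaito2020]
-/

noncomputable section

set_option linter.dupNamespace false -- mandated namespace `Summit.<Summit>.<Problem>` of this single-conjunct summit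

open IsLocalRing Literature.AlgebraicGeometry.Resolution
open Summit.ResolutionOfSingularities.ResolutionOfSingularities.Theorems
open Summit.ResolutionOfSingularities.ResolutionOfSingularities.Cruxes.HypersurfaceCentreConstruction.LocalEngine.Iota3.RatContact

namespace Summit.ResolutionOfSingularities.ResolutionOfSingularities.Cruxes.HypersurfaceCentreConstruction.LocalEngine

namespace Iota3

/-! ## §1 Coarse triples: the levels are extended -/

section DimThree

variable {S S' : Type} [CommRing S] [CommRing S'] [IsRegularLocalRing S] [IsRegularLocalRing S'] [Algebra S S']
  [IsLocalHom (algebraMap S S')] [Algebra.FormallySmooth S S'] [Algebra.EssFiniteType S S']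

/-- **THE LEVELS OF A COARSE (`q = r₂`) REACHING FLAG ARE EXTENDED.**  `φ : S → S'` local, formally smooth, e.f.t. between regular local rings of
dimension three with `𝔪_S S' = 𝔪_{S'}`; `f ∈ 𝔪 ∖ 0`, `ν = ord f`, `0 < r₂ ≤ r₁`; `(g₁', g₂')` a two-flag of `S'` with
`φ f ∈ F'(r₁ν)`, `F' = flagContactFiltration g₁' g₂' r₂ r₁ r₂`.  Then `F'(r₁) = J₁ S'` and `F'(r₂) = J₂ S'` for ideals `J₁, J₂ ⊆ S` (indeed
`Jₙ = ratContactFiltration y r₁ r₂ n` for a rational `y` with `g₁' ≡ u·φ y`). [cite: Hironaka1967, §3, Thm. (4.8)] [OURS · L1 W4.3] -/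
theorem levels_extended_of_r₂_eq_q (h𝔪 : (maximalIdeal S).map (algebraMap S S') = maximalIdeal S')
    (hdim : ringKrullDim S = (3 : ℕ)) (hdim' : ringKrullDim S' = (3 : ℕ)) {f : S} (hf0 : f ≠ 0) (hf : f ∈ maximalIdeal S)
    {g₁' g₂' : S'} (hfl : IsTwoFlag g₁' g₂') {r₁ r₂ : ℕ} (hr₂ : 0 < r₂) (hr : r₂ ≤ r₁)
    (hmem : algebraMap S S' f ∈ flagContactFiltration g₁' g₂' r₂ r₁ r₂ (r₁ * (adicOrder f).toNat)) :
    ∃ J₁ J₂ : Ideal S, J₁.map (algebraMap S S') = flagContactFiltration g₁' g₂' r₂ r₁ r₂ r₁ ∧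
      J₂.map (algebraMap S S') = flagContactFiltration g₁' g₂' r₂ r₁ r₂ r₂ := by
  obtain ⟨hν, -, hford⟩ := EssSmoothLevels.adicOrder_toNat_spec hf0 hf
  have hford' : algebraMap S S' f ∉ maximalIdeal S' ^ ((adicOrder f).toNat + 1) := fun h =>
    hford ((IotaOrderEssSmooth.mem_maximalIdeal_pow_iff_of_formallySmooth S S' _ f).mpr h)
  -- the collapse at `q = r₂`
  have hcol : ∀ n, flagContactFiltration g₁' g₂' r₂ r₁ r₂ n = ratContactFiltration g₁' r₁ r₂ n := fun n =>
    flagContactFiltration_eq_ratContactFiltration hfl.2.1 hr₂ n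
  have hreach : algebraMap S S' f ∈ ratContactFiltration g₁' r₁ r₂ (r₁ * (adicOrder f).toNat) := by rw [← hcol]; exact hmem
  -- a rational `y` with `g₁' ≡ u · φ y (mod 𝔪'^⌈r₁/r₂⌉)`
  obtain ⟨y, u, hu, hcong⟩ : ∃ (y : S) (u : S'), IsUnit u ∧
      g₁' - u * algebraMap S S' y ∈ maximalIdeal S' ^ ((r₁ + r₂ - 1) / r₂) := by
    rcases hr.eq_or_lt with heq | hlt
    · -- slope `1`: any regular parameter, the congruence modulo `𝔪'` is free
      subst heq
      obtain ⟨x, hx, -⟩ : ∃ x ∈ maximalIdeal S, x ∉ maximalIdeal S ^ 2 :=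
        SetLike.exists_of_lt (IsLocalRing.maximalIdeal_sq_lt_of_ringKrullDim_ne_zero (by rw [hdim]; norm_num))
      refine ⟨x, 1, isUnit_one, ?_⟩
      have h1 : (r₂ + r₂ - 1) / r₂ = 1 := Nat.div_eq_of_lt_le (by omega) (by omega)
      rw [h1, pow_one, one_mul]
      exact Ideal.sub_mem _ hfl.1 (h𝔪 ▸ Ideal.mem_map_of_mem _ hx)
    · -- slope `> 1`: one-member descent, then C2 upstairs
      obtain ⟨y, hy, hy2, hfy⟩ := JFlatEssSmooth.oneFlagReaches_of_algebraMap h𝔪 hdim hdim' hf0 hf hr₂ r₁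
        ⟨g₁', hfl.1, hfl.left_not_mem_sq, hreach⟩
      have hφy : algebraMap S S' y ∈ maximalIdeal S' := h𝔪 ▸ Ideal.mem_map_of_mem _ hy
      have hφy2 : algebraMap S S' y ∉ maximalIdeal S' ^ 2 := fun h2 =>
        hy2 ((IotaOrderEssSmooth.mem_maximalIdeal_pow_iff_of_formallySmooth S S' 2 y).mpr h2)
      have hfy' : algebraMap S S' f ∈ ratContactFiltration (algebraMap S S' y) r₁ r₂ (r₁ * (adicOrder f).toNat) :=
        (RatContactEssSmooth.algebraMap_mem_ratContactFiltration_iff h𝔪 f y r₁ r₂ _).mpr hfy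
      obtain ⟨u, hu⟩ := RatContactCanonical.exists_unit_sub_mul_mem_pow_of_mem_ratContactFiltration hfl.1 hfl.left_not_mem_sq
        hφy hφy2 hr₂ hlt hν hford' hreach hfy'
      exact ⟨y, u, u.isUnit, hu⟩
  -- the levels are the rational filtration of `y`, extended
  have hRC : ∀ n, ratContactFiltration g₁' r₁ r₂ n = (ratContactFiltration y r₁ r₂ n).map (algebraMap S S') := fun n => by
    rw [RatContactEssSmooth.ratContactFiltration_eq_of_sub_unit_mul_mem_pow hu hr₂ hcong n,
      RatContactEssSmooth.map_ratContactFiltration h𝔪]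
  exact ⟨ratContactFiltration y r₁ r₂ r₁, ratContactFiltration y r₁ r₂ r₂, by rw [hcol, hRC], by rw [hcol, hRC]⟩

end DimThree

/-! ## §2 (IDLmax-desc)₃ is needed at `q < r₂` only -/

/-- **(IDLmax-desc)₃ ⟸ (IDLmax-desc)₃ at `q < r₂`** (the coarse maximisers `q = r₂` have extended levels by `levels_extended_of_r₂_eq_q`).
[OURS · L1 W4.3 · audit glue] -/
theorem maxIdealDescent_of_lt
    (hidlmax : ∀ (T T' : Type) [CommRing T] [IsRegularLocalRing T] [CommRing T'] [IsRegularLocalRing T'] [Algebra T T']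
      [IsLocalHom (algebraMap T T')] [Algebra.FormallySmooth T T'] [Algebra.EssFiniteType T T'] (g : T),
      ringKrullDim T = (3 : ℕ) → ringKrullDim T' = (3 : ℕ) → (maximalIdeal T).map (algebraMap T T') = maximalIdeal T' →
      g ≠ 0 → g ∈ maximalIdeal T → iotaEps T g = 0 → ∀ (g₁' g₂' : T') (q r₁ r₂ : ℕ),
      IsSigmaMaximiser (algebraMap T T' g) (adicOrder g).toNat g₁' g₂' q r₁ r₂ → q < r₂ →
      ∃ J₁ J₂ : Ideal T, J₁.map (algebraMap T T') = flagContactFiltration g₁' g₂' q r₁ r₂ r₁ ∧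
        J₂.map (algebraMap T T') = flagContactFiltration g₁' g₂' q r₁ r₂ r₂) :
    ∀ (T T' : Type) [CommRing T] [IsRegularLocalRing T] [CommRing T'] [IsRegularLocalRing T'] [Algebra T T']
      [IsLocalHom (algebraMap T T')] [Algebra.FormallySmooth T T'] [Algebra.EssFiniteType T T'] (g : T),
      ringKrullDim T = (3 : ℕ) → ringKrullDim T' = (3 : ℕ) → (maximalIdeal T).map (algebraMap T T') = maximalIdeal T' →
      g ≠ 0 → g ∈ maximalIdeal T → iotaEps T g = 0 → ∀ (g₁' g₂' : T') (q r₁ r₂ : ℕ),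
      IsSigmaMaximiser (algebraMap T T' g) (adicOrder g).toNat g₁' g₂' q r₁ r₂ →
      ∃ J₁ J₂ : Ideal T, J₁.map (algebraMap T T') = flagContactFiltration g₁' g₂' q r₁ r₂ r₁ ∧
        J₂.map (algebraMap T T') = flagContactFiltration g₁' g₂' q r₁ r₂ r₂ := by
  intro T T' _ _ _ _ _ _ _ _ g hd hd' h𝔪 hg0 hg hε g₁' g₂' q r₁ r₂ hmax
  rcases hmax.1.2.1.eq_or_lt with heq | hlt
  · subst heq
    exact levels_extended_of_r₂_eq_q h𝔪 hd hd' hg0 hg hmax.2.1 hmax.1.1 hmax.1.2.2 hmax.2.2.1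
  · exact hidlmax T T' g hd hd' h𝔪 hg0 hg hε g₁' g₂' q r₁ r₂ hmax hlt

end Iota3

/-! ## §3 The gap list -/

open Iota3 in
/-- **P3 RUNG FOR THE NAMED PAIR MODULO SIX HYPOTHESES, BOTH IDEAL-DESCENT INPUTS AT `q < r₂` ONLY**: (desc-τ); (IDL-desc)₃ (levels of flags
reaching a max-ratio triple, `q < r₂`); (IDLmax-desc)₃ (levels of σ-maximisers with `q < r₂`, `ε = 0`); (EX-asc)₃; hgame; the residue of the
dominance word at the power positions. [OURS · L1 W4.3 · audit glue] -/
theorem keyRungGrHomLE_three_of_idealDescentLT3 (p : ℕ)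
    (hD : ∀ (T T' : Type) [CommRing T] [IsRegularLocalRing T] [CommRing T'] [IsRegularLocalRing T'] [Algebra T T']
      [IsLocalHom (algebraMap T T')] [Algebra.FormallySmooth T T'] [Algebra.EssFiniteType T T'] (g : T),
      ringKrullDim T' ≤ 3 → IsTiePosition T' (algebraMap T T' g) → IsTiePosition T g)
    (hidl : ∀ (A A' : Type) [CommRing A] [IsRegularLocalRing A] [CommRing A'] [IsRegularLocalRing A'] [Algebra A A']
      [IsLocalHom (algebraMap A A')] [Algebra.FormallySmooth A A'] [Algebra.EssFiniteType A A'] (g : A),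
      ringKrullDim A = (3 : ℕ) → ringKrullDim A' = (3 : ℕ) → (maximalIdeal A).map (algebraMap A A') = maximalIdeal A' →
      g ≠ 0 → g ∈ maximalIdeal A → ∀ q r₁ r₂ : ℕ, AdmissibleTriple q r₁ r₂ → q < r₂ →
      ratioScale (adicOrder g).toNat * r₁ = sigmaRatioNat g * r₂ →
      ∀ g₁' g₂' : A', IsTwoFlag g₁' g₂' →
      algebraMap A A' g ∈ flagContactFiltration g₁' g₂' q r₁ r₂ (r₁ * (adicOrder g).toNat) →
      ∃ J₁ J₂ : Ideal A, J₁.map (algebraMap A A') = flagContactFiltration g₁' g₂' q r₁ r₂ r₁ ∧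
        J₂.map (algebraMap A A') = flagContactFiltration g₁' g₂' q r₁ r₂ r₂)
    (hidlmax : ∀ (T T' : Type) [CommRing T] [IsRegularLocalRing T] [CommRing T'] [IsRegularLocalRing T'] [Algebra T T']
      [IsLocalHom (algebraMap T T')] [Algebra.FormallySmooth T T'] [Algebra.EssFiniteType T T'] (g : T),
      ringKrullDim T = (3 : ℕ) → ringKrullDim T' = (3 : ℕ) → (maximalIdeal T).map (algebraMap T T') = maximalIdeal T' →
      g ≠ 0 → g ∈ maximalIdeal T → iotaEps T g = 0 → ∀ (g₁' g₂' : T') (q r₁ r₂ : ℕ),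
      IsSigmaMaximiser (algebraMap T T' g) (adicOrder g).toNat g₁' g₂' q r₁ r₂ → q < r₂ →
      ∃ J₁ J₂ : Ideal T, J₁.map (algebraMap T T') = flagContactFiltration g₁' g₂' q r₁ r₂ r₁ ∧
        J₂.map (algebraMap T T') = flagContactFiltration g₁' g₂' q r₁ r₂ r₂)
    (hexasc : ∀ (T T' : Type) [CommRing T] [IsRegularLocalRing T] [CommRing T'] [IsRegularLocalRing T'] [Algebra T T']
      [IsLocalHom (algebraMap T T')] [Algebra.FormallySmooth T T'] [Algebra.EssFiniteType T T'] (g : T),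
      ringKrullDim T = (3 : ℕ) → ringKrullDim T' = (3 : ℕ) → (maximalIdeal T).map (algebraMap T T') = maximalIdeal T' →
      g ≠ 0 → g ∈ maximalIdeal T → iotaEps T g = 0 →
      (∃ (G₁ G₂ : T) (q r₁ r₂ : ℕ), IsSigmaMaximiser g (adicOrder g).toNat G₁ G₂ q r₁ r₂) →
      ∃ (h₁ h₂ : T') (Q R₁ R₂ : ℕ), IsSigmaMaximiser (algebraMap T T' g) (adicOrder g).toNat h₁ h₂ Q R₁ R₂)
    (hgame : CanonicalGameClauseHomLE 3 p iotaFlatT jFlatT)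
    (hres : ∀ (k₀ : Type) [Field k₀] [CharP k₀ p] [PerfectField k₀]
      (S : Type) [CommRing S] [Algebra k₀ S] [Algebra.EssFiniteType k₀ S] [IsRegularLocalRing S] (f : S),
      ringKrullDim S = (3 : ℕ) → f ≠ 0 → f ∈ (maximalIdeal S) ^ 2 →
      ContactCylinder.topStratumPrime iotaOrdEpsTau S f = maximalIdeal S → iotaEps S f ≠ 1 →
      (∃ ℓ ∈ maximalIdeal S, f ∈ Ideal.span {ℓ ^ (adicOrder f).toNat} ⊔ maximalIdeal S ^ ((adicOrder f).toNat + 1)) →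
      ∀ (a b : ℕ), 0 < b →
      (∀ q' r₁' r₂' : ℕ, AdmissibleTriple q' r₁' r₂' → FlagReaches f (adicOrder f).toNat q' r₁' r₂' → r₁' * b ≤ a * r₂') →
      ∀ (g₁ g₂ g₁' g₂' : S) (q r₁ r₂ : ℕ), AdmissibleTriple q r₁ r₂ → r₁ * b = a * r₂ → q < r₂ → r₂ < r₁ →
        IsTwoFlag g₁ g₂ → IsTwoFlag g₁' g₂' →
        f ∈ flagContactFiltration g₁ g₂ q r₁ r₂ (r₁ * (adicOrder f).toNat) →
        f ∈ flagContactFiltration g₁' g₂' q r₁ r₂ (r₁ * (adicOrder f).toNat) →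
        g₂' ∈ flagContactFiltration g₁ g₂ q r₁ r₂ r₂) :
    KeyRungGrHomLE 3 p :=
  keyRungGrHomLE_three_of_idealDescent3' p hD hidl (maxIdealDescent_of_lt hidlmax) hexasc hgame hres

end Summit.ResolutionOfSingularities.ResolutionOfSingularities.Cruxes.HypersurfaceCentreConstruction.LocalEngine

end
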